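import Summits.BirchSwinnertonDyer.BirchSwinnertonDyer.Theorems.PrintX11aLowerHalfThreePartner
import Summits.BirchSwinnertonDyer.BirchSwinnertonDyer.Theorems.PrintX11aLowerHalfThreeKodairaMemberByName
import HarnessLib

/-!
# Crux `X11aLowerHalf` (item stmt-BirchSwinnertonDyer-19064) at `p = 3` — class-level TURNKEYS for the line's
# lead: the deep `p = 3` locus cut three ways (Kodaira ∕ finite-flat-with-partner ∕ très ramifié) and the whole
# crux body from the registered `p ≥ 5` certificate stub plus the two `p = 3` residual statements
# (`--supports stmt-BirchSwinnertonDyer-19064` helper; seat bsd-line-er5-p2 = -w3 width seat of the 19064 line)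

HONEST FRAMING. Theorems only; no definition, no named fact, no `sorry`; NO route file imported. Every theorem
is CONDITIONAL on displayed named facts and on displayed `∀`-hypotheses over sub-loci of the deep X11a pairs at
`p = 3`; NOTHING here is claimed about those hypotheses (one is a per-pair EXISTENCE of a partner, the other is
the open core). Nothing closes the crux or a stub by itself. BSD is proved for no curve. beyond-print theorem: no.

## The cut (for the lead; his call — `stub_memberRatEqAtThree` ↦ three pieces, or r3's `stub_lowerThreeDeep` ↦ same)

Deep X11a pairs at `p = 3` (`ClassX11a W 3 ∧ ¬ X11a.ShaAnUnit W 3`; in range `N < 5·10⁵`: 448 classes) =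
* KODAIRA sub-locus `K(W) := Surj W 3 ∧ ∃ v additive, 3 ∣ #Φ_v(𝔽̄_v), p_v³ ∤ N` — CLOSED from named facts by
  g3 (`lowerThree_on_kodaira_of_facts`, p623401: SU 3.6.4-ram at a level-lowered weight-6 member, Ribet's
  additive drop, Carayol–Livné; 91 classes);
* FINITE-FLAT remainder `¬ K(W) ∧ 3 ∣ ord₃ Δ_min(W)` (`E[3]|_{G_{ℚ₃}}` peu ramifié; 71 classes) — CLOSED from
  named facts GIVEN a good-ordinary `3`-congruent partner per pair (`ThreePartner` doors, this seat:
  EPW Thm. 1 ×2 + Cor. 5.1.4 at an odd prime, Yan–Zhu Thm. 4.9, period unit at 3); displayed hypothesis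
  `hpartner` = «every such pair HAS a partner» — per pair a finite certificate (a curve `A` + a Kraus–Oesterlé
  congruence list), class-wide a statement about Rubin–Silverberg's mod-3 family `X_E(3) ≅ ℙ¹` plus a
  `3`-adic Serre–Tate argument, NOT in the tree and NOT claimed here;
* TRÈS-RAMIFIÉ remainder `¬ K(W) ∧ 3 ∤ ord₃ Δ_min(W)` (286 classes) — NO partner exists (a good curve's
  `A[3]` is finite flat at `3`), no member of `H(E[3])` has a (ram) prime, no weight-`k > 2` source prints
  `p = 3`: displayed hypothesis `htres` = the lower half there, the OPEN CORE of the crux at `3`.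

## What

* `lowerThree_onPartnerLocus_of_facts` — r3-stub-shaped: at every deep X11a pair at `3` WITH a displayed
  partner, the lower half (21 named facts).
* `lowerThreeDeep_of_kodaira_of_partner_of_tresRamifie_of_facts` — r3's registered statement `stub_lowerThreeDeep`
  (`∀ W p, ClassX11a W p → p = 3 → ¬ X11a.ShaAnUnit W p → MissingLowerBoundAt W p`) from 24 named facts +
  `hpartner` + `htres`.
* `x11aLowerHalf_body_of_muAnFive_kodaira_partner_tresRamifie_of_facts` — the WHOLE crux body (the unfolding
  of `Theses.ErratumRoadFive.X11aLowerHalf` = `Theses.PrintX11a.X11aLowerHalf`) from 25 named facts + the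
  registered `p ≥ 5` certificate statement (`stub_muAnDeepFive`) + `hpartner` + `htres`.

References: [EmertonPollackWeston2006] Thm. 1, Cor. 5.1.4; [YanZhu2024MainConjNonCM] Thm. 4.9 (v4 Thm. 5.2);
[SkinnerUrban2014] Thm. 3.6.4; [DarmonDiamondTaylor1995] Thm. 3.15; [Serre1987] §2.8 Prop. 4;
[RubinSilverberg1995] Thm. 1 (reading only; not used); [GreenbergLNM1716] Conj. 1.11; [Miller2011LMS] Def. 1.1;
cell files `pub/bsd-stepL/line-er5-p2/g3/KODAIRA-MEMBER.md` §6, `…/g4/`.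
-/

set_option autoImplicit false
set_option linter.dupNamespace false -- the directory name repeats the summit name (sibling precedent)

noncomputable section

open scoped Classical MatrixGroups ModularForm

open CongruenceSubgroup UpperHalfPlane WeierstrassCurve IsDedekindDomain Rat.HeightOneSpectrum
  Literature.NumberTheory.EllipticCurves
  Literature.NumberTheory.EllipticCurves.ModularForms
  Literature.NumberTheory.EllipticCurves.Rank1Residual
  Literature.NumberTheory.EllipticCurves.Rank1Residual.Typed
  Literature.NumberTheory.EllipticCurves.Wuthrich2014
  Literature.NumberTheory.EllipticCurves.SteinWuthrich2013
  Literature.NumberTheory.EllipticCurves.Greenberg1999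
  Literature.NumberTheory.EllipticCurves.Kato2004
  Literature.NumberTheory.EllipticCurves.GreenbergVatsal2000
  Literature.NumberTheory.EllipticCurves.EmertonPollackWeston2006
  Literature.NumberTheory.EllipticCurves.SkinnerUrban2014
  Literature.NumberTheory.GaloisRepresentations
  Literature.NumberTheory.Automorphic
  Summit.BirchSwinnertonDyer.Rank1Residual
  Summit.BirchSwinnertonDyer.Rank1Residual.X11a

namespace Summit.BirchSwinnertonDyer.BirchSwinnertonDyer.Theorems.ThreePartner

/-! ### §5 The finite-flat-with-partner sub-locus, class-level -/

/-- **At every deep X11a pair with `p = 3` carrying a displayed good-ordinary `3`-congruent partner, the lower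
half** — from 21 named facts (EPW ×3 odd-prime weight-two instances, Yan–Zhu 4.9, period unit at 3, Mazur's
Manin constant, Kato–Wuthrich A32 + Lemma 20, Kato 12.4 ∕ §17.13 ×3 ∕ Greenberg 1.5 ∕ Wuthrich Cor. 18,
Stein–Wuthrich 6.1 ×2, GZK, Greenberg–Stevens, modularity). The `¬ ShaAnUnit` antecedent is idle (kept for the
registered stub shape). CONDITIONAL; closes nothing by itself. [cite: EmertonPollackWeston2006, Thm. 1, Cor. 5.1.4 (arXiv:math/0404484 pp. 2, 30)]
[cite: YanZhu2024MainConjNonCM, Thm. 4.9 (§4.4; v4 Thm. 5.2)] [cite: Miller2011LMS, Def. 1.1] -/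
theorem lowerThree_onPartnerLocus_of_facts
    (hNf : exists_isNewformOf) (hEPW : cor514_transfer_of_goodOrdinary_odd)
    (hYZ : YanZhu2026.thm49_charIdeal_eq_padicLFunction) (h3 : realPeriodRat_eq_unit_mul_plusPeriod_three)
    (hTa : thm1_muAlg_transfer_goodOrdinary_of_mult_odd) (hTn : thm1_muAn_transfer_goodOrdinary_of_mult_odd)
    (hMz : mazur_not_dvd_maninConstant_of_odd)
    (hKato : kato_charIdeal_dvd_multiplicative_of_surjective) (h20 : lemma20_surjective_threeAdic_of_semistable)
    (h12 : Kato2004.thm12_4) (hns : Kato2004.exists_multDivisibilityInputs_nonsplit)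
    (hsp : Kato2004.exists_multDivisibilityInputs_split) (h15 : thm15_isTorsion_multiplicative_rat)
    (h18 : Wuthrich2014.corollary18_padicLFunction_mem_iwasawaAlgebra_multiplicative)
    (hfine : Kato2004.exists_multDivisibilityInputs_fine)
    (hJs : thm61_splitMultiplicative) (hJn : thm61_nonsplitMultiplicative)
    (hGZK : rank_eq_analyticRank_of_analyticRank_le_one)
    (hGS : ∀ (W : WeierstrassCurve ℚ) [W.IsElliptic] [W.IsGloballyMinimal] (p : ℕ) [Fact p.Prime],
      greenberg_stevens (W := W) (p := p)) :
    ∀ (W : WeierstrassCurve ℚ) [W.IsElliptic] [W.IsGloballyMinimal] (p : ℕ) [Fact p.Prime],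
      ClassX11a W p → p = 3 → ¬ X11a.ShaAnUnit W p →
      (∃ (A : WeierstrassCurve ℚ) (_ : A.IsElliptic) (_ : A.IsGloballyMinimal),
        A.HasGoodReductionAtPrime p ∧ ¬ (p : ℤ) ∣ A.frobeniusTrace p ∧
        ∃ e : geomTorsion W (p : ℤ) ≃+ geomTorsion A (p : ℤ),
          ∀ (σ : Field.absoluteGaloisGroup ℚ) (P : geomTorsion W (p : ℤ)), e (σ • P) = σ • e P) →
      MissingLowerBoundAt W p := by
  intro W _ _ p _ hX hp3 _ ⟨A, hAE, hAM, hgoodA, hordA, hiso⟩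
  exact hX.missingLowerBoundAt_three_of_partner_of_facts A hNf hEPW hYZ h3 hTa hTn hMz hKato h20 h12 hns hsp h15 h18
    hfine hJs hJn hGZK (hGS W p) hp3 hgoodA hordA hiso

/-! ### §6 The three-way cut of the deep `p = 3` locus: r3's registered statement `stub_lowerThreeDeep` -/

/-- **r3's registered stub `stub_lowerThreeDeep` (VERBATIM statement: the lower half at every deep X11a pair
with `p = 3`, both images) from 24 named facts and TWO displayed `∀`-hypotheses on the off-Kodaira deep
locus**: `hpartner` — on its FINITE-FLAT part (`3 ∣ ord₃ Δ_min`) every pair has a good-ordinary `3`-congruent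
partner (per pair a certificate; class-wide NOT in the tree, NOT claimed); `htres` — on its TRÈS-RAMIFIÉ part
(`3 ∤ ord₃ Δ_min`) the lower half itself (the OPEN CORE; no source in print). The Kodaira sub-locus is g3's
`lowerThree_on_kodaira_of_facts` (SU 3.6.4-ram `hSU`, Ribet's additive drop `hRk`, Carayol–Livné `hCL`).
CONDITIONAL; closes nothing by itself. [cite: EmertonPollackWeston2006, Thm. 1, Cor. 5.1.4]
[cite: YanZhu2024MainConjNonCM, Thm. 4.9] [cite: SkinnerUrban2014, Thm. 1 (p. 2) = Thm. 3.6.4 (p. 43)]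
[cite: DarmonDiamondTaylor1995, Thm. 3.15] [cite: Serre1987, §2.8 Prop. 4] [cite: Miller2011LMS, Def. 1.1] -/
theorem lowerThreeDeep_of_kodaira_of_partner_of_tresRamifie_of_facts
    (hNf : exists_isNewformOf)
    (h311 : thm311_cotorsion_weightK_member_ofLevel_odd) (hT1a : thm1_muAlg_of_weightK_member_ofLevel_odd)
    (hT1b : thm513_transfer_from_weightK_member_of_bdd_ofLevel_odd)
    (h61 : DeligneSerre1974.thm61_exists_adicGaloisRep) (h326 : Hida2000_thm326_ordinary)
    (hKato : kato_charIdeal_dvd_multiplicative_of_surjective) (h20 : lemma20_surjective_threeAdic_of_semistable)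
    (h12 : Kato2004.thm12_4) (hns : Kato2004.exists_multDivisibilityInputs_nonsplit)
    (hsp : Kato2004.exists_multDivisibilityInputs_split) (h15 : thm15_isTorsion_multiplicative_rat)
    (h18 : Wuthrich2014.corollary18_padicLFunction_mem_iwasawaAlgebra_multiplicative)
    (hfine : Kato2004.exists_multDivisibilityInputs_fine)
    (hJs : thm61_splitMultiplicative) (hJn : thm61_nonsplitMultiplicative)
    (hGZK : rank_eq_analyticRank_of_analyticRank_le_one)
    (hGS : ∀ (W : WeierstrassCurve ℚ) [W.IsElliptic] [W.IsGloballyMinimal] (p : ℕ) [Fact p.Prime],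
      greenberg_stevens (W := W) (p := p))
    (hMz : mazur_not_dvd_maninConstant_of_odd)
    -- g3's Kodaira sub-locus facts
    (hSU : thm364_rational_weightK_member_of_bdd_ofLevel_ram)
    (hRk : ribet1990_levelLowering_gamma0_newform_at_three_additiveDrop)
    (hCL : carayolLivne_additivePrime_dvd_level_of_congruent_newform)
    -- the partner road's facts
    (hEPW : cor514_transfer_of_goodOrdinary_odd)
    (hYZ : YanZhu2026.thm49_charIdeal_eq_padicLFunction) (h3 : realPeriodRat_eq_unit_mul_plusPeriod_three)
    (hTa : thm1_muAlg_transfer_goodOrdinary_of_mult_odd) (hTn : thm1_muAn_transfer_goodOrdinary_of_mult_odd)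
    -- the two displayed residual statements on the off-Kodaira deep locus at 3
    (hpartner : ∀ (W : WeierstrassCurve ℚ) [W.IsElliptic] [W.IsGloballyMinimal] (p : ℕ) [Fact p.Prime],
      ClassX11a W p → p = 3 → ¬ X11a.ShaAnUnit W p →
      ¬ (Surj W p ∧ ∃ v : HeightOneSpectrum ℤ, W.HasAdditiveReductionAt v ∧
          3 ∣ (W.kodairaSymbolAt v).componentGroupOrder ∧ ¬ natGenerator v ^ 3 ∣ W.conductorNorm ℤ) →
      p ∣ padicValInt p W.minimalDiscriminantInt →
      ∃ (A : WeierstrassCurve ℚ) (_ : A.IsElliptic) (_ : A.IsGloballyMinimal),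
        A.HasGoodReductionAtPrime p ∧ ¬ (p : ℤ) ∣ A.frobeniusTrace p ∧
        ∃ e : geomTorsion W (p : ℤ) ≃+ geomTorsion A (p : ℤ),
          ∀ (σ : Field.absoluteGaloisGroup ℚ) (P : geomTorsion W (p : ℤ)), e (σ • P) = σ • e P)
    (htres : ∀ (W : WeierstrassCurve ℚ) [W.IsElliptic] [W.IsGloballyMinimal] (p : ℕ) [Fact p.Prime],
      ClassX11a W p → p = 3 → ¬ X11a.ShaAnUnit W p →
      ¬ (Surj W p ∧ ∃ v : HeightOneSpectrum ℤ, W.HasAdditiveReductionAt v ∧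
          3 ∣ (W.kodairaSymbolAt v).componentGroupOrder ∧ ¬ natGenerator v ^ 3 ∣ W.conductorNorm ℤ) →
      ¬ p ∣ padicValInt p W.minimalDiscriminantInt → MissingLowerBoundAt W p) :
    ∀ (W : WeierstrassCurve ℚ) [W.IsElliptic] [W.IsGloballyMinimal] (p : ℕ) [Fact p.Prime],
      ClassX11a W p → p = 3 → ¬ X11a.ShaAnUnit W p → MissingLowerBoundAt W p := by
  intro W _ _ p _ hX hp3 hu
  by_cases hK : Surj W p ∧ ∃ v : HeightOneSpectrum ℤ, W.HasAdditiveReductionAt v ∧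
      3 ∣ (W.kodairaSymbolAt v).componentGroupOrder ∧ ¬ natGenerator v ^ 3 ∣ W.conductorNorm ℤ
  · -- the Kodaira sub-locus (g3)
    exact OddChain.lowerThree_on_kodaira_of_facts hNf h311 hT1a hT1b h61 h326 hKato h20 h12 hns hsp h15
      h18 hfine hJs hJn hGZK hGS hMz hSU hRk hCL W p hX hp3 hK.1 hK.2
  · by_cases hff : p ∣ padicValInt p W.minimalDiscriminantInt
    · -- finite flat at 3: the partner road
      exact lowerThree_onPartnerLocus_of_facts hNf hEPW hYZ h3 hTa hTn hMz hKato h20 h12 hns hsp h15 h18 hfine hJs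
        hJn hGZK hGS W p hX hp3 hu (hpartner W p hX hp3 hu hK hff)
    · -- très ramifié at 3: the open core
      exact htres W p hX hp3 hu hK hff

/-! ### §7 The whole crux body -/

/-- **The WHOLE body of crux `X11aLowerHalf` (`∀` X11a pairs, the lower half — the unfolding of
`Theses.ErratumRoadFive.X11aLowerHalf` = `Theses.PrintX11a.X11aLowerHalf`; no route file imported) from 25
named facts, the registered `p ≥ 5` certificate statement `stub_muAnDeepFive` (`hcert5`, Greenberg's analytic
`μ` on the deep X11a locus at `p ≥ 5`), and the two displayed `p = 3` residual statements `hpartner` ∕ `htres`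
of §6** — g0's `NonSurjChain.x11aLowerHalf_body_of_three_of_forall_muAnZeroAt_of_facts` with the `5 ≤ p` EPW
instances obtained from the odd ones and the `p = 3` deep part supplied by §6. Reading, modulo named facts:
crux L = [analytic `μ` at the deep X11a pairs, `p ≥ 5`] + [a good-ordinary `3`-congruent partner at every
finite-flat off-Kodaira deep pair at `3`] + [the lower half at the 286-class très-ramifié core at `3`].
CONDITIONAL; closes nothing by itself. [cite: EmertonPollackWeston2006, Thm. 1, Thm. 5.1.3, Cor. 5.1.4]
[cite: Wan2015, Thm. 4 (p. 4)] [cite: YanZhu2024MainConjNonCM, Thm. 4.9] [cite: GreenbergLNM1716, Conj. 1.11 (shape)]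
[cite: Miller2011LMS, Def. 1.1] -/
theorem x11aLowerHalf_body_of_muAnFive_kodaira_partner_tresRamifie_of_facts
    (hNf : exists_isNewformOf)
    (h311 : thm311_cotorsion_weightK_member_ofLevel_odd) (hT1a : thm1_muAlg_of_weightK_member_ofLevel_odd)
    (hT2 : Wan2015.thm4_rational_weightK_member_of_bdd_ofLevel_irred)
    (hT1b : thm513_transfer_from_weightK_member_of_bdd_ofLevel_odd)
    (h61 : DeligneSerre1974.thm61_exists_adicGaloisRep) (h326 : Hida2000_thm326_ordinary)
    (hKato : kato_charIdeal_dvd_multiplicative_of_surjective) (h20 : lemma20_surjective_threeAdic_of_semistable)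
    (h12 : Kato2004.thm12_4) (hns : Kato2004.exists_multDivisibilityInputs_nonsplit)
    (hsp : Kato2004.exists_multDivisibilityInputs_split) (h15 : thm15_isTorsion_multiplicative_rat)
    (h18 : Wuthrich2014.corollary18_padicLFunction_mem_iwasawaAlgebra_multiplicative)
    (hfine : Kato2004.exists_multDivisibilityInputs_fine)
    (hJs : thm61_splitMultiplicative) (hJn : thm61_nonsplitMultiplicative)
    (hGZK : rank_eq_analyticRank_of_analyticRank_le_one)
    (hGS : ∀ (W : WeierstrassCurve ℚ) [W.IsElliptic] [W.IsGloballyMinimal] (p : ℕ) [Fact p.Prime],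
      greenberg_stevens (W := W) (p := p))
    (hMz : mazur_not_dvd_maninConstant_of_odd)
    (hSU : thm364_rational_weightK_member_of_bdd_ofLevel_ram)
    (hRk : ribet1990_levelLowering_gamma0_newform_at_three_additiveDrop)
    (hCL : carayolLivne_additivePrime_dvd_level_of_congruent_newform)
    (hEPW : cor514_transfer_of_goodOrdinary_odd)
    (hYZ : YanZhu2026.thm49_charIdeal_eq_padicLFunction) (h3 : realPeriodRat_eq_unit_mul_plusPeriod_three)
    (hTa : thm1_muAlg_transfer_goodOrdinary_of_mult_odd) (hTn : thm1_muAn_transfer_goodOrdinary_of_mult_odd)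
    (hcert5 : ∀ (W : WeierstrassCurve ℚ) [W.IsElliptic] [W.IsGloballyMinimal] (p : ℕ) [Fact p.Prime],
      ClassX11a W p → 5 ≤ p → ¬ X11a.ShaAnUnit W p → X11a.MuAnZeroAt W p)
    (hpartner : ∀ (W : WeierstrassCurve ℚ) [W.IsElliptic] [W.IsGloballyMinimal] (p : ℕ) [Fact p.Prime],
      ClassX11a W p → p = 3 → ¬ X11a.ShaAnUnit W p →
      ¬ (Surj W p ∧ ∃ v : HeightOneSpectrum ℤ, W.HasAdditiveReductionAt v ∧
          3 ∣ (W.kodairaSymbolAt v).componentGroupOrder ∧ ¬ natGenerator v ^ 3 ∣ W.conductorNorm ℤ) →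
      p ∣ padicValInt p W.minimalDiscriminantInt →
      ∃ (A : WeierstrassCurve ℚ) (_ : A.IsElliptic) (_ : A.IsGloballyMinimal),
        A.HasGoodReductionAtPrime p ∧ ¬ (p : ℤ) ∣ A.frobeniusTrace p ∧
        ∃ e : geomTorsion W (p : ℤ) ≃+ geomTorsion A (p : ℤ),
          ∀ (σ : Field.absoluteGaloisGroup ℚ) (P : geomTorsion W (p : ℤ)), e (σ • P) = σ • e P)
    (htres : ∀ (W : WeierstrassCurve ℚ) [W.IsElliptic] [W.IsGloballyMinimal] (p : ℕ) [Fact p.Prime],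
      ClassX11a W p → p = 3 → ¬ X11a.ShaAnUnit W p →
      ¬ (Surj W p ∧ ∃ v : HeightOneSpectrum ℤ, W.HasAdditiveReductionAt v ∧
          3 ∣ (W.kodairaSymbolAt v).componentGroupOrder ∧ ¬ natGenerator v ^ 3 ∣ W.conductorNorm ℤ) →
      ¬ p ∣ padicValInt p W.minimalDiscriminantInt → MissingLowerBoundAt W p) :
    ∀ (W : WeierstrassCurve ℚ) [W.IsElliptic] [W.IsGloballyMinimal] (p : ℕ) [Fact p.Prime],
      ClassX11a W p → MissingLowerBoundAt W p :=
  NonSurjChain.x11aLowerHalf_body_of_three_of_forall_muAnZeroAt_of_facts hNf (OddChain.thm311_ofLevel_of_odd h311)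
    (OddChain.thm1_ofLevel_of_odd hT1a) hT2 (OddChain.thm513_ofLevel_of_odd hT1b) h61 h326 hKato h12 hns hsp h15 h18
    hfine hJs hJn hGZK hGS
    (lowerThreeDeep_of_kodaira_of_partner_of_tresRamifie_of_facts hNf h311 hT1a hT1b h61 h326 hKato h20 h12 hns hsp
      h15 h18 hfine hJs hJn hGZK hGS hMz hSU hRk hCL hEPW hYZ h3 hTa hTn hpartner htres)
    hcert5

end Summit.BirchSwinnertonDyer.BirchSwinnertonDyer.Theorems.ThreePartner

end
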